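import Summits.BirchSwinnertonDyer.BirchSwinnertonDyer.Theses.ByReductionTypeAtTwo
import Summits.BirchSwinnertonDyer.Rank1Residual.F1Sign2.DescentSignAtTwo
import Literature.NumberTheory.EllipticCurves.PAdicHeights
import Literature.NumberTheory.EllipticCurves.BSDRootNumberSmallConductorProofs
import Literature.NumberTheory.EllipticCurves.GlobalMinimalModel
import Summits.BirchSwinnertonDyer.Rank1Residual.F1Sign2.LevelRaisingAtTwo
import HarnessLib

/-!
# Cell `bsd-f1-sign2` — ES lens (-es g20, MEMO-es §29; D-es-73): ES-29 «THE SECOND RECIPROCITY LAW OF MOD-2 LEVEL RAISING — THE SIGN OF THE LEVEL-RAISED CURVE»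
# (ES-29A `LevelRaisedSignLawAtTwo`, shadows ES-29N/U, ES-29M (2 ∥ N), ES-29G (good 2), the typed sub-frame theorem ES-29A♮ `LevelRaisedSignLawAtTwoSemistableOdd`, + -es's sign-algebra glue)

STATEMENTS ONLY (+ -es's glue theorems, pure sign algebra), typer -ty g18.  Port asked by -es g20 (D-es-73 «port Sketch29 next to the §28 port»), REF-GATED until REF1 g17 §191
(D-es-71, INBOX 2026-08-29T11:38:12Z) and REF1 g18 §197 (R197a, 13:05:37Z).  Source: `HOME/data-es/g20/lean/Sketch29.lean` **6c0bf595c6e14062** (237 l., rc 0, 0 sorry; -es's farm logs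
`Sketch29_probe.out`/`Sketch29_probe2.out` rc 0 · 0 warnings, `#h21_crux_probe` CLEAN 5/5; = -es's PRE-REFEREE crux copy `Cruxes/RankOneAtTwoBigImageOddLocal/SignReciprocityES29.lean` —
cite THIS file); REF1's probe `HOME/REF1-data/b191/lean/Probe191.lean` **80a9b1e83b986bc2** (Sketch29 verbatim under ns `…F1Sign2.REF1s191` + 5 sorry probes + 7 sorry-free BC7 lemmas; farm
rc 0 per REF1 g18 §192).  HOMING as for ES-27/ES-28/ES-30: `Summits/…/Theorems/` is prover-only for the gate (D-0016), so the file lives in the cell folder `F1Sign2/` under -es's OWN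
namespace `…Theorems.RankOneAtTwoSignReciprocity` as sketched.  **R191d / R194e / R197b APPLIED: the sketch's re-declarations of `twoDivCubic`, `ModTwoCongruent`, `IsMinRealRoot`,
`IsMaxRealRoot`, `NontrivialAtTwo`, `MonodromyBitAtTwo` are DROPPED (bodies byte-identical to ES-28's) and ES-28's decls (`F1Sign2/LevelRaisingAtTwo.lean`, namespace
`…Theorems.RankOneAtTwoLevelRaising`) are imported and `open`ed by name instead; -es's `SendsMinToMin` (body byte-identical to ES-28's `SameRealKummerLine`) is an `abbrev` for it
(REF1 §196 R196e «one tree name»)**; everything else VERBATIM — `SendsMaxToMax`, `RealTwistEven`, `TwoTorsionHalvableModQ`, `levelRaisedSignFactor`, the five rows (`@[conjecture]`,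
kept until Lean proofs land) and the seven glue theorems (bodies byte-identical to the sketch AND Probe191, builder-verified); docstrings verbatim + one REF1-AUDIT and one
REF2-PLACEMENT rider each; three cite keys mapped to the tree's keys for the same sources (`Ribet1990ICM` ↦ `Ribet1990RaisingLevels`, `Cassels1998JRAM` ↦ `Cassels1998`,
`SilvermanAdvanced` ↦ `SilvermanAdvancedTopics1994`).  ONE TYPER ADDITION (R191a = R197a, REF1's wording): `LevelRaisedSignLawAtTwoSemistableOdd` = ES-29A + the binder «no additive
odd prime» + `semistableOdd_of_signLaw`.
GRADES (REF1-AUDIT §191 D-es-71 + §197 D-es-78, evidence `HOME/REF1-data/b191/`, `b197/` SHA16.txt): ES-29A SURVIVES (conjecture-candidate as typed = G ∧ M); ES-29N/U SURVIVE (shadows,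
glue proved); ES-29M THEOREM-candidate / ES-29G THEOREM on the sub-frame «odd part of `N_W` squarefree» — REF1's paper audit of (T2)–(T8) ALL PASS, Honda-free, enumeration-free;
the ONE residue = no local sign identity at an ADDITIVE odd `p ∣ N_W` (census-clean) ⟹ ES-29A♮ is a THEOREM ON PAPER; KILLED none.  Second engines: -es SR29 (kit j330250) 217 966/217 966
per-place identities, frame 91 167/91 167 (12/12 admissible cells populated, 12/12 forbidden empty), R0-29 rank-0 bases 5 937/5 937 (REF1 re-tally 5 937 + 3 516), E29-R1 = LHL's
printed Examples 19–21: 13/13.  REF2-PLACEMENT v53 §6 (D-es-72) / §12.2 / §15.1 (b029f6daca38610c): LAW NOT IN PRINT (nearest [cite: LeHungLi2016, Thm. 15, Ex. 19–21] = phenomenon +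
existence; sibling [cite: GreenMaistret2022, Thm. 2.11]); ES-29A ⟺ relative 2-Selmer parity with β-correction via [cite: Monsky1996] (E29-R3); (T3)'s `γ_E` IN PRINT
[cite: Yelton2015, Prop. 2.8]; (L-ss-ii) COROLLARY OF PRINT [cite: Cesnavicius2016SelmerFlat, §5]; print-assembly route to ES-29A (LHL L.45/47 + Kramer + Monsky) OPEN (E30-R1); grade NEW-COMBINATION.
PARTITION none.  Beyond-print theorem (BSD): no.  BSD is not proved.  bears_on: stmt-BirchSwinnertonDyer-23715.

## -es's module docstring of `Sketch29.lean` (verbatim)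

# ES-29 (cell bsd-f1-sign2, seat -es g20): THE SECOND RECIPROCITY LAW OF MOD-2 LEVEL RAISING — THE SIGN OF THE LEVEL-RAISED CURVE

Sketch only (planner seat; nothing here is proposed to the tree; the typer ports).  Crux `RankOneAtTwoBigImageOddLocal`
(stmt-BirchSwinnertonDyer-23715).  Continuation of ES-28 (g19, `Sketch28.lean`: level-raising Euler system at `p = 2` over `ℚ` at a
TRANSPOSITION prime `q`, `(Δ_W/q) = −1`, `W'` of conductor `N_W q` with `W'[2] ≅ W[2]`).

MECHANISM (the «signed object at 2» of this lens).  Write `ρ_{W',4} = (1 + 2c)·ρ_{W,4}` with `c ∈ Z¹(ℚ, End W[2])`.  As an `S₃`-module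
`End W[2] = 𝔽₂[S₃/A₃] ⊕ W[2]`, so `[c] = (ψ, ξ) ∈ H¹(F, 𝔽₂) ⊕ H¹(ℚ, W[2])`, `F = ℚ(√Δ_W)`; `tr c = 0` forces `ψ = res_F χ_{d'}` (`d' ∈ ℚˣ`
mod `⟨Δ_W, ℚˣ²⟩`: «`W'[4]` is `W^{(d')}[4]` up to the `W[2]`-part»), and — THEOREM of the memo (MEMO-es §29 (T3)) — the `W[2]`-part is the
product of differents `ξ = β(W,W') = f'_W(θ)·f'_{W'}(θ') = γ_W + γ_{W'}` in `ker(N : K₃ˣ/K₃ˣ² → ℚˣ/ℚˣ²) = H¹(ℚ, W[2])`, where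
`γ_W := −Δ_W·f'_W(θ)` is the class cutting out the `S₄`-field inside `ℚ(W[4])`.  Hilbert reciprocity for `(d', −Δ_W)` over `ℚ` and for
`(β, γ_W)` in the cubic field `K₃`, with the local dictionary at `q`, at the multiplicative `p ∣ N_W`, and at `∞`, gives the LAW

  `#{p ∣ N_W : w_p(W') ≠ w_p(W)} ≡ t_q(W')·n_q(W) + κ_∞(W,W') + C₂ (mod 2)`,

`t_q = [v_q(Δ_{W'}) ≡ 2 (4)]` (`W'[4]` ramified at `q`), `n_q(W) = [4 ∤ #W̃(𝔽_q)]` (`= [a_q(W) ≢ q+1 (mod 4)]`: Ribet's congruence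
`a_q ≡ ε_q (q+1)` read MOD 4), `κ_∞ = [σ moves both the smallest and the largest real 2-division abscissa]` (`σ` the root bijection of the
congruence; `0` if `Δ_W < 0`), and `C₂` a `2`-adic symbol which VANISHES on the frame `4 ∤ N_W`, `ρ̄|_{G_{ℚ₂}} ≠ 1` (conjecture ES-29B; for
`2 ∥ N_W` half of it is automatic).  Equivalently (root numbers: `w(W') = −w(W)·ε_q·(−1)^{#flips}`):  THE SIGN OF THE LEVEL-RAISED CURVE IS
`w(W') = −w(W) · ε_q · (ε*_q)^{t_q} · (−1)^{κ_∞}`,  `ε*_q := +1` if `4 ∣ #W̃(𝔽_q)` else `−1`.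
Census (BC5 witness): ENGINE LR28 rows (g19, kit j329192+j329376, sha16 4d420fce83dfd191) analysed by `analyse29_offline.py` 152a25a4aa8d925a:
91 167 / 91 167 frame rows (`r_an(W) = 1`; `ε_q = −1`: 45 110, `+1`: 46 057; `2 ∤ N`: 21 748, `2 ∥ N`: 69 419; `Δ<0`: 37 479, `Δ>0`: 53 688),
0 violations; all 12 admissible cells of the 5-bit table `(sgn Δ, t, n, κ, #flips mod 2)` populated, all inadmissible cells empty; OFF the frame
(`4 ∣ N_W`) `C₂ = 1` on 59 560 / 123 979 rows (so the frame hypothesis is load-bearing), constant on fine Kodaira cells at `2`.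
-/

noncomputable section

open scoped Classical

set_option linter.dupNamespace false
set_option autoImplicit false

namespace Summit.BirchSwinnertonDyer.BirchSwinnertonDyer.Theorems.RankOneAtTwoSignReciprocity

open Literature.NumberTheory.EllipticCurves Summit.BirchSwinnertonDyer.Rank1Residual.F1Sign2 WeierstrassCurve
open Summit.BirchSwinnertonDyer.BirchSwinnertonDyer.Theorems.RankOneAtTwoLevelRaising
  (twoDivCubic ModTwoCongruent IsMinRealRoot IsMaxRealRoot SameRealKummerLine NontrivialAtTwo MonodromyBitAtTwo)

/-- **`σ(e_min) = e'_min`**: the congruence sends the smallest real `2`-division abscissa of `W` to that of `W'` (`= L_∞(W) = L_∞(W')`,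
ES-28 `SameRealKummerLine`; automatic when `Δ_W < 0`).
TYPER -ty g18 (R191d / R194e / REF1 §196 R196e «one tree name»): -es's `SendsMinToMin` has EXACTLY the body of ES-28's tree decl `SameRealKummerLine`
(`F1Sign2/LevelRaisingAtTwo.lean`, ns `…Theorems.RankOneAtTwoLevelRaising`), so it is filed as an `abbrev` for that decl (definitionally equal; -es's name kept for the §29 prose
and for `RealTwistEven` below, whose body stays verbatim).  REF1-AUDIT §191 BC7: on the slice (mod-2 surjective ⟹ S₃, `Aut K₃ = 1`) the σ is UNIQUE, so the `∃ σ ∀ ι` shape =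
«THE root bijection sends `e_min ↦ e′_min`» ✓; `sendsMinToMin_refl` (identity congruence) in REF1's probe. -/
abbrev SendsMinToMin (W W' : WeierstrassCurve ℚ) : Prop := SameRealKummerLine W W'

/-- **`σ(e_max) = e'_max`**: the congruence sends the largest real `2`-division abscissa of `W` to that of `W'` (automatic when `Δ_W < 0`).
REF1-AUDIT §191 BC7: faithful (same `∃ σ ∀ ι` reading as `SendsMinToMin`; off-slice cyclic-cubic case excluded by the surjectivity binder — note only). -/
def SendsMaxToMax (W W' : WeierstrassCurve ℚ) : Prop :=
  ∃ σ : AdjoinRoot (twoDivCubic W) ≃ₐ[ℚ] AdjoinRoot (twoDivCubic W'),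
    ∀ ι : AdjoinRoot (twoDivCubic W') →ₐ[ℚ] ℝ,
      IsMaxRealRoot (twoDivCubic W) (ι (σ (AdjoinRoot.root (twoDivCubic W)))) ↔
        IsMaxRealRoot (twoDivCubic W') (ι (AdjoinRoot.root (twoDivCubic W')))

/-- **`κ_∞(W,W') = 0` — the archimedean twist of the congruence is EVEN**: the root bijection `σ` fixes the smallest OR the largest
abscissa, i.e. `σ ∈ {id, (min mid), (mid max)}`; it is ODD (`κ_∞ = 1`) for `σ ∈ {(min max), 3-cycles}`.  Cohomologically
`κ_∞ = ⟨β, γ_W⟩_∞ + ψ_∞ = [σ(e_mid) ≠ e'_mid] + [σ an odd permutation]` (MEMO-es §29 (T4)).  Always even when `Δ_W < 0`.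
REF1-AUDIT §191 BC7: `= «σ ∈ {id, (min mid), (mid max)}» = κ_∞ = 0` ✓, consistent with (T4•∞) `κ_∞ = [σ(e_mid) ≠ e′_mid] + [σ odd]` (id 0+0, (min mid) 1+1, (mid max) 1+1 even;
(min max) 0+1, 3-cycles 1+0 odd ✓); `Δ_W < 0`: exactly one real `ι`, both sides of the ↔ true ⟹ `SendsMinToMin W W' ↔ ModTwoCongruent W W'` ⟹ `RealTwistEven` holds, so the
hypothesis `hreal` of `neg_of_signLaw` is a TRUE fact (real-root counting); `realTwistEven_refl` in REF1's probe.  REF1 §197 (P2d) COROLLARY: `ψ_∞ = [σ odd]` is now DERIVED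
from ES-30b (`F1Sign2/ScalarCharacterAtTwo.lean`), no longer resting on memo + engine. -/
def RealTwistEven (W W' : WeierstrassCurve ℚ) : Prop := SendsMinToMin W W' ∨ SendsMaxToMax W W'

/-- **`n_q(W) = 0` — the `𝔽_q`-rational `2`-torsion point is halvable**: `4 ∣ #W̃(𝔽_q)` (at a transposition prime `W̃(𝔽_q)[2] ≅ ℤ/2`, so this
is `T ∈ 2W̃(𝔽_q)`, `⇔ f'_W(θ_q) ∈ 𝔽_qˣ²`, `⇔ a_q(W) ≡ q + 1 (mod 4)`: Ribet's level-raising congruence `a_q ≡ ε(q+1) (mod 2)` READ MOD 4 with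
the sign `ε*_q = +1`).  `W.reductionPointCount q = #W̃(𝔽_q)` for `W` globally minimal with good reduction at `q`.
REF1-AUDIT §191 BC7: tree `reductionPointCount` = `Nat.card` of the reduction's `Point` type = non-singular affine points PLUS `O` = `#W̃(𝔽_q)` at good `q` ✓ (the «affine
count» slip is NOT made); at a transposition prime `W̃(𝔽_q)[2] ≅ ℤ/2`, so `4 ∣ # ⟺ T halvable ⟺ a_q ≡ q+1 (mod 4)` ✓.  REF2-PLACEMENT v53 §6.3 (T2): `n_q(E) = [(f′_E(e_w)/q) = −1]`
by the 2-descent halving criterion [cite: SchaeferStoll2004] — PRINT-ASSEMBLY (elementary); -es's 217 966/217 966 is thus a check of print. -/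
def TwoTorsionHalvableModQ (W : WeierstrassCurve ℚ) [W.IsGloballyMinimal] (q : ℕ) : Prop := 4 ∣ W.reductionPointCount q

/-- **The predicted sign factor of mod-`2` level raising at a transposition prime**:
`s(W,W',q) = ε_q · (ε*_q)^{t_q} · (−1)^{κ_∞}` with `ε_q = ±1` the split/non-split sign of `W'` at `q`, `ε*_q = −1` iff `4 ∤ #W̃(𝔽_q)`,
`t_q = [v_q(Δ_{W'}) ≡ 2 (4)]`, `κ_∞` the archimedean twist.  The law says `w(W') = −w(W)·s(W,W',q)`.
REF1-AUDIT §191 BC7: `= ε_q·(−1)^{[t_q ∧ n_q]}·(−1)^{[¬RealTwistEven]} ∈ {±1}` (`signFactor_cases`, sorry-free, kernel file) — so «= −1» is a genuine dichotomy ✓; the first factor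
reads `−1` also for a NON-multiplicative `q`, harmless because every row carries `W'.HasMultiplicativeReductionAtPrime q`; `MonodromyBitAtTwo` is ES-28's tree decl (R191d: reused,
not re-declared). -/
def levelRaisedSignFactor (W W' : WeierstrassCurve ℚ) [W.IsGloballyMinimal] (q : ℕ) [Fact q.Prime] : ℤ :=
  (if W'.HasSplitMultiplicativeReductionAtPrime q then 1 else -1) *
    (if MonodromyBitAtTwo W' q ∧ ¬ TwoTorsionHalvableModQ W q then -1 else 1) *
    (if RealTwistEven W W' then 1 else -1)

/-- **ES-29A `LevelRaisedSignLawAtTwo` — THE SECOND RECIPROCITY LAW OF MOD-2 LEVEL RAISING: THE ROOT NUMBER OF THE LEVEL-RAISED CURVE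
(CONJECTURE-candidate of this lens = «law + `C₂ = 0` on the frame»; the law with an unspecified `2`-adic symbol `C₂(W,W')` is a theorem
sketch, MEMO-es §29 (T1)–(T5)).**  FRAME: `W` of the slice (non-CM, `ρ_{W,2^n}` onto for all `n`, odd torsion, odd Tamagawa product — so every
multiplicative `p ∣ N_W` has `v_p(Δ_W)` odd), `4 ∤ N_W`, `ρ̄|_{G_{ℚ₂}} ≠ 1`; `q ∤ 2N_W` prime with `(Δ_W/q) = −1`; `W'` globally minimal of conductor
`N_W q`, congruent to `W` mod `2`, multiplicative at `q` of EITHER sign.  THEN, writing root numbers as parities of analytic ranks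
(`w = (−1)^{r_an}`):   `w(W')·w(W) = −ε_q·(ε*_q)^{t_q}·(−1)^{κ_∞}`,  i.e.
`r_an(W') ≡ r_an(W) (mod 2)  ⟺  levelRaisedSignFactor W W' q = −1`.
In words: raising the level mod `2` at `q` flips an ODD number of local signs at `p ∣ N_W` exactly when [`W'[4]` ramifies at `q` AND Ribet's
congruence `a_q(W) ≡ ε(q+1)` fails mod `4` for `ε = +1`] XOR [the congruence moves both extreme real `2`-division abscissae].
Why it might fail: the `2`-adic symbol `C₂ = r₂(ψ) + ⟨β,γ_W⟩₂` might not vanish on some `2`-adic class inside the frame not met by the census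
(all `(v₂N, Kodaira(W), Kodaira(W'))` cells met so far are clean, incl. differing Kodaira types at `2 ∥ N`); at an ADDITIVE odd `p ∣ N_W` the local
dictionary is unproved (census-clean); the census has `r_an(W) = 1` only (`w(W) = −1`; the `w(W) = +1` base is untested but the mechanism is
symmetric).  OFF the frame the statement is FALSE as typed (`4 ∣ N_W`: 59 560 / 123 979 counterexamples; `ρ̄|_{G_{ℚ₂}} = 1`: 1 523 / 2 820).
Census: module docstring.  [cite: Ribet1990RaisingLevels, Thm. 1 (level raising: a_q ≡ ±(q+1) mod ℓ)] [cite: DiamondTaylor1994, Thm. A]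
[cite: LeHungLi2016, Thm. 15, Lemma 44–45 (mod-2 level raising with signs; the lines at a transposition prime)]
[cite: Cassels1998, §2 (H¹(ℚ,E[2]) ⊂ K₃ˣ/K₃ˣ²; local pairing = sum of Hilbert symbols over w ∣ v)] [cite: PoonenRains2012, Thm. 4.14, Prop. 2.6 (self-cup-product
= connecting map of the theta characteristic / Heisenberg extension)] [cite: DokchitserDokchitserAnnals2010, Thm. 1.4 (2-parity)]
REF1-AUDIT §191 (D-es-71, Sketch29 6c0bf595c6e14062; Probe191 80a9b1e83b986bc2) + §197 (D-es-78): **SURVIVES — conjecture-candidate EXACTLY AS TYPED (= G ∧ M, glue in this file),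
and a THEOREM on the sub-frame «odd part of `N_W` squarefree»**: REF1's paper audit covers EVERY local identity — (T2) trace identities, (T3) `ξ = β` (proof reconstructed in full),
(T4•mult) incl. `p = 2` and (L-mult) by the exact Tate `q`-expansion `(e₁−e₂)(e₁−e₃) ∈ 1/16 + qℤ[[q]]`, (T4•q) re-derived (§197 P7), (T4•∞), (T5) assembly by the two product
formulas, (T6), (T7) = (L-ord-i) + unique stable line, (T8) = (L-ss-i)+(L-ss-ii)+(L-ss-iii) (§197 P3–P6) — ALL PASS, Honda-free, enumeration-free.  THE ONE RESIDUE (R191a =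
R197a): at an ADDITIVE odd `p ∣ N_W` (admitted by `Odd W.tamagawaProduct`: II, II*, IV, IV*, I₀*) there is no local sign identity `w_p(E)w_p(E′) = (d′,−Δ_E)_p(β,γ_E)_p` on
paper; census-clean there (SR29; R0-29 additive bases 50·, 54·, 75·, 98·, …); 40 973 of the 91 167 frame rows have a base with `p² ∣ N_W`, `p` odd (§194) — hence the typed
sub-frame version `LevelRaisedSignLawAtTwoSemistableOdd` below.  BC7 binders: LOAD-BEARING `¬ 4 ∣ N_W` (59 560/123 979 off-frame counterexamples), `NontrivialAtTwo`
(1 523/2 820), `Odd W.tamagawaProduct` (only through «`v_p(Δ_W)` odd at every multiplicative `p`»), mod-2 surjectivity; APPARENTLY IDLE (R191c, optional weakening for a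
prover): `¬ W.HasCM`, `Odd W.torsionOrder`, surjectivity mod `2ⁿ` for `n ≥ 2`.  The `∀`-form over `w(W) = ±1` is the right one (the derivation never uses `r_an(W)`); rank-0
bases now tested: MEMO-es §30.4 TABLE R0-29 5 937/5 937 (REF1 §197 re-tally 5 937/5 937 + 3 516/3 516; R0-29 bases are mod-2-surjective, a SUPERSET of the 2-adic frame).
E29-R1 (REF2's mandatory check against the one printed table, [cite: LeHungLi2016, Ex. 19–21]): 13/13 (11a1 at q = 7 → 77a1/77b1/77b2/77b3; 35a1 at q = 19, 23, 31), LHL's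
«only − at 11» = `φ(11) = t_7·n_7 = 1`, «all 8 patterns at q = 31» realised by NON-rational newforms only (MEMO-es §30.4).
REF2-PLACEMENT v53 §6 (D-es-72) / §12.2 / §15.1 (b029f6daca38610c): the LAW is NOT IN PRINT as a statement; nearest print = [cite: LeHungLi2016, Thm. 15, Ex. 19–21] (the
PHENOMENON «when ℓ = 2 the signs cannot be detected from the congruence» + an EXISTENCE theorem «all but possibly one p ∥ N», exception removed iff `Δ > 0` or an additive `p`
with `v_p(Δ)` odd — EXACTLY the two places where ES-29's one Hilbert-reciprocity relation on `χ_D χ_{−Δ_E}` is absorbable, §15.1 verified verbatim) and the sibling local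
discrepancy [cite: GreenMaistret2022, Thm. 2.11] for a different (isogeny-linked) pair — now EXPLAINED by this mechanism (GM-H, `F1Sign2/GreenMaistretErrorTerm.lean`, a
THEOREM by REF1 §199).  Print frame (§6.2): `w(E)w(E′) = (−1)^{s₂(E)+s₂(E′)}` by [cite: Monsky1996, Thm. 1.5] / [cite: DokchitserDokchitserAnnals2010, Thm. 1.4] ⟹ ES-29A ⟺
(ES-29A-Sel) «relative 2-Selmer parity with β-correction» unconditionally (E29-R3); the β-correction is FORCED by print-level linear algebra (two curves' Poonen–Rains forms
differ by the theta-torsor class β; the companion literature [cite: MazurRubin2015SelmerCompanions] / [cite: Yu2019TwoSelmerNearCompanion] / [cite: SelmerCompanionForms2025]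
sits at `β = 0`, `E[4] ≅ A[4]`, and excludes good reduction at 2); (T3)'s `γ_E = −Δ_E f′_E(θ)` = the Kummer class of `ℚ(x(E[4]))/ℚ(E[2])` is IN PRINT
[cite: Yelton2015, Prop. 2.8, Thm. 3.1]; `ξ = β` itself, the local sign identity, (L-mult), (T6), (T7), (L-ss-i), (L-ss-iii) and the LAW: NOT IN PRINT.  §12.2(c): a PRINT-ASSEMBLY ROUTE to ES-29A on LHL's
Assumption-7 frame (LHL Lemma 45 + 47 one-place switching + Kramer 1981 local conditions + Monsky) is OPEN (ask E30-R1; if it closes the sign law's grade drops to print-assembly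
and the beyond-print claim re-bases on ES-29G / ES-30b).  GRADE of record: NEW-COMBINATION («joined object `β = γ_Eγ_{E′}` as deformation class unpublished; upgrade candidate»),
priors LHL2016, GM2022, PR2012, MR2015, KMR2013.  PARTITION none; beyond-print theorem (BSD): no; BSD not proved.  Typer: `Ribet1990RaisingLevels` ↦ tree key `Ribet1990RaisingLevels`,
`Cassels1998` ↦ `Cassels1998` in the cite tags below (same papers). -/
@[conjecture] def LevelRaisedSignLawAtTwo : Prop :=
  ∀ (W W' : WeierstrassCurve ℚ) [W.IsElliptic] [W.IsGloballyMinimal] [W'.IsElliptic] [W'.IsGloballyMinimal]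
    (q : ℕ) [Fact q.Prime],
    ¬ W.HasCM → (∀ n : ℕ, W.HasSurjectiveModNGaloisRep ((2 ^ n : ℕ) : ℤ)) → Odd W.torsionOrder → Odd W.tamagawaProduct →
    ¬ (4 : ℕ) ∣ W.conductorNorm ℤ → NontrivialAtTwo W →
    q ≠ 2 → ¬ (q : ℤ) ∣ (W.conductorNorm ℤ : ℤ) → jacobiSym W.Δ.num q = -1 → W'.conductorNorm ℤ = q * W.conductorNorm ℤ →
    ModTwoCongruent W W' → W'.HasMultiplicativeReductionAtPrime q →
      ((Even W'.analyticRank ↔ Even W.analyticRank) ↔ levelRaisedSignFactor W W' q = -1)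

/-- **ES-29N `LevelRaisedSignLawAtTwoNeg` — the `Δ_W < 0` shadow** (no archimedean twist): `r_an(W') ≡ r_an(W) (mod 2)` iff
[`W'` split at `q` ⟺ (`v_q(Δ_{W'}) ≡ 2 (4)` ∧ `4 ∤ #W̃(𝔽_q)`)].  In particular (`t_q = 0`): if `4 ∣ v_q(Δ_{W'})` then the level-raised curve has
the parity of `W` iff it is NON-split at `q` — mod-`2` level raising with `4`-unramified `W'[4]` never flips an odd number of signs at `p ∣ N_W`.
Frame rows with `Δ_W < 0`: 37 479 / 37 479.  Same sources as ES-29A.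
REF1-AUDIT §191: **SURVIVES** (shadow; `neg_of_signLaw` proved below modulo the TRUE one-real-root fact `hreal`).  Frame rows `Δ_W < 0`: 37 479/37 479; REF2 v53 §6.5: no print. -/
@[conjecture] def LevelRaisedSignLawAtTwoNeg : Prop :=
  ∀ (W W' : WeierstrassCurve ℚ) [W.IsElliptic] [W.IsGloballyMinimal] [W'.IsElliptic] [W'.IsGloballyMinimal]
    (q : ℕ) [Fact q.Prime],
    ¬ W.HasCM → (∀ n : ℕ, W.HasSurjectiveModNGaloisRep ((2 ^ n : ℕ) : ℤ)) → Odd W.torsionOrder → Odd W.tamagawaProduct →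
    ¬ (4 : ℕ) ∣ W.conductorNorm ℤ → NontrivialAtTwo W →
    q ≠ 2 → ¬ (q : ℤ) ∣ (W.conductorNorm ℤ : ℤ) → jacobiSym W.Δ.num q = -1 → W'.conductorNorm ℤ = q * W.conductorNorm ℤ →
    ModTwoCongruent W W' → W'.HasMultiplicativeReductionAtPrime q → W.Δ < 0 →
      ((Even W'.analyticRank ↔ Even W.analyticRank) ↔
        (W'.HasSplitMultiplicativeReductionAtPrime q ↔ (MonodromyBitAtTwo W' q ∧ ¬ TwoTorsionHalvableModQ W q)))

/-- **ES-29U `LevelRaisedSignLawAtTwoUnram` — the `4`-unramified shadow** (`t_q = 0`, no dependence on `a_q mod 4`): if `4 ∣ v_q(Δ_{W'})` then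
`w(W')·w(W) = −ε_q·(−1)^{κ_∞}`.  Frame rows with `t_q = 0`: 29 671 / 29 671.
REF1-AUDIT §191: **SURVIVES** (shadow; `unram_of_signLaw` proved below, pure sign algebra).  REF2 v53 §6.5: no print. -/
@[conjecture] def LevelRaisedSignLawAtTwoUnram : Prop :=
  ∀ (W W' : WeierstrassCurve ℚ) [W.IsElliptic] [W.IsGloballyMinimal] [W'.IsElliptic] [W'.IsGloballyMinimal]
    (q : ℕ) [Fact q.Prime],
    ¬ W.HasCM → (∀ n : ℕ, W.HasSurjectiveModNGaloisRep ((2 ^ n : ℕ) : ℤ)) → Odd W.torsionOrder → Odd W.tamagawaProduct →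
    ¬ (4 : ℕ) ∣ W.conductorNorm ℤ → NontrivialAtTwo W →
    q ≠ 2 → ¬ (q : ℤ) ∣ (W.conductorNorm ℤ : ℤ) → jacobiSym W.Δ.num q = -1 → W'.conductorNorm ℤ = q * W.conductorNorm ℤ →
    ModTwoCongruent W W' → W'.HasMultiplicativeReductionAtPrime q → (4 : ℤ) ∣ padicValRat q W'.Δ →
      ((Even W'.analyticRank ↔ Even W.analyticRank) ↔ (W'.HasSplitMultiplicativeReductionAtPrime q ↔ ¬ RealTwistEven W W'))

/-- Sign algebra: with an even archimedean twist the factor is `−1` iff `ε_q = (ε*_q)^{t_q}·(−1)`… i.e. split `⇔ (t_q ∧ n_q)`. -/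
theorem signFactor_eq_neg_one_iff_of_realTwistEven (W W' : WeierstrassCurve ℚ) [W.IsGloballyMinimal] (q : ℕ) [Fact q.Prime]
    (hκ : RealTwistEven W W') :
    levelRaisedSignFactor W W' q = -1 ↔
      (W'.HasSplitMultiplicativeReductionAtPrime q ↔ (MonodromyBitAtTwo W' q ∧ ¬ TwoTorsionHalvableModQ W q)) := by
  unfold levelRaisedSignFactor
  by_cases hs : W'.HasSplitMultiplicativeReductionAtPrime q <;>
    by_cases ht : (MonodromyBitAtTwo W' q ∧ ¬ TwoTorsionHalvableModQ W q) <;> simp [hs, ht, hκ]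

/-- Sign algebra (-es; docstring added by the typer for `lint.docstring`): with `t_q = 0` (`¬ MonodromyBitAtTwo W' q`) the factor is `−1` iff (`W'` split at `q` ⟺ the
archimedean twist is ODD). -/
theorem signFactor_eq_neg_one_iff_of_unram (W W' : WeierstrassCurve ℚ) [W.IsGloballyMinimal] (q : ℕ) [Fact q.Prime]
    (ht : ¬ MonodromyBitAtTwo W' q) :
    levelRaisedSignFactor W W' q = -1 ↔ (W'.HasSplitMultiplicativeReductionAtPrime q ↔ ¬ RealTwistEven W W') := by
  unfold levelRaisedSignFactor
  by_cases hs : W'.HasSplitMultiplicativeReductionAtPrime q <;> by_cases hk : RealTwistEven W W' <;> simp [hs, ht, hk]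

/-- ES-29A ⟹ ES-29U (pure sign algebra). -/
theorem unram_of_signLaw (h : LevelRaisedSignLawAtTwo) : LevelRaisedSignLawAtTwoUnram := by
  intro W W' _ _ _ _ q _ h1 h2 h3 h4 h5 h6 hq hgood htr hlev hc hm ht
  have key := h W W' q h1 h2 h3 h4 h5 h6 hq hgood htr hlev hc hm
  rw [key]
  exact signFactor_eq_neg_one_iff_of_unram W W' q (fun h' => h' ht)

/-- ES-29A ⟹ ES-29N given that the archimedean twist is even when `Δ_W < 0` (hypothesis `hreal`, the one-real-root fact; kept as a
hypothesis so that this file proves only sign algebra).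
REF1-AUDIT §191: `hreal` is TRUE (Δ_W < 0 ⟹ one real embedding ⟹ `SendsMinToMin ⟺ ModTwoCongruent`); fine to keep as a hypothesis in a sign-algebra file. -/
theorem neg_of_signLaw (h : LevelRaisedSignLawAtTwo)
    (hreal : ∀ (W W' : WeierstrassCurve ℚ), ModTwoCongruent W W' → W.Δ < 0 → RealTwistEven W W') : LevelRaisedSignLawAtTwoNeg := by
  intro W W' _ _ _ _ q _ h1 h2 h3 h4 h5 h6 hq hgood htr hlev hc hm hneg
  have key := h W W' q h1 h2 h3 h4 h5 h6 hq hgood htr hlev hc hm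
  rw [key]
  exact signFactor_eq_neg_one_iff_of_realTwistEven W W' q (hreal W W' hc hneg)

/-- **ES-29M `LevelRaisedSignLawAtTwoMult` — the MULTIPLICATIVE-AT-2 case (`2 ∥ N_W`): THEOREM-candidate** (proved on paper, MEMO-es §29.1 (T6):
at a multiplicative `2` the dyadic symbol is `C₂ = [(s₂,−Δ_W)₂ = −1] + [(s₂, −Δ_W·f'_W(e_{T_μ}))₂ = −1]` and `f'_W(e_{T_μ}) ∈ ℚ₂ˣ²` on a Tate curve,
so `C₂ = 0`; census `v₂N = 1`: 69 419 / 69 419).  No `NontrivialAtTwo` binder is needed (`v₂(Δ_W)` odd forces `ρ̄|_{G_{ℚ₂}} ≠ 1`).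
Why it might still fail as typed: an ADDITIVE odd `p ∣ N_W` (local dictionary there unproved; census-clean) or a slip in the `q`/`∞` dictionary for
`w(W) = +1` bases (untested by census).  Same sources as ES-29A + [cite: SilvermanAdvancedTopics1994, Thm. V.3.1, V.5.3 (Tate curve over ℚ_p incl. p = 2)].
REF1-AUDIT §191 R191a/R191e + §197: **SURVIVES — THEOREM-candidate on the semistable-away-from-2 frame** («odd part of `N_W` squarefree»; (T6) PASS: `c|G₂ = (e+n₂)Id + n₂τ_{T_μ}`,
`χ_{d′}|G₂ = ε₂χ_{s₂}`, `loc₂β = χ_{s₂} ∪ T_μ`, `γ_{T_μ} ≡ −Δ_W` by (L-mult) — proved by the exact Tate `q`-expansion `(e₁−e₂)(e₁−e₃) = (1/16)(1 + 16qH(q))`, `H ∈ ℤ[[q]]`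
(certificate `REF1-data/b191/data/lmult_qexp.py`), and by the residue route `F ≡ X²(X+b₂) (mod 8)` (`lordI_mod8`, `lordI_hensel`, kernel file) ⟹ `C₂ = 2·(…) = 0`); as typed
(an ADDITIVE odd `p ∣ N_W` admitted) it is a conjecture-candidate, census-clean; R191b (write-up): the sign of `s_p = √(q_{W′}/q_W)` is fixed by the global mod-2 identification.
REF2-PLACEMENT v53 §6.5: lands only with a Lean proof or as a route crux; print inputs = Tate-curve Kummer theory [cite: Kramer1981, Prop. 1–2] + (T1)–(T5); nothing in print
states it; §12.3/§18: [cite: LeHungLi2016, Lemma 45] (4)(5) covers `2 ∥ N` with any Tate parameters exactly under «ρ̄ ramified at 2» — the unramified-at-2 multiplicative sub-case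
is EMPTY in the typed frame (`Odd tamagawaProduct ⟹ c₂` odd ⟹ `v₂(Δ_W)` odd, REF1 §196-add1 (c) / REF2 §18).  Typer: `SilvermanAdvanced` ↦ tree key `SilvermanAdvancedTopics1994`. -/
@[conjecture] def LevelRaisedSignLawAtTwoMult : Prop :=
  ∀ (W W' : WeierstrassCurve ℚ) [W.IsElliptic] [W.IsGloballyMinimal] [W'.IsElliptic] [W'.IsGloballyMinimal]
    (q : ℕ) [Fact q.Prime],
    ¬ W.HasCM → (∀ n : ℕ, W.HasSurjectiveModNGaloisRep ((2 ^ n : ℕ) : ℤ)) → Odd W.torsionOrder → Odd W.tamagawaProduct →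
    (2 : ℕ) ∣ W.conductorNorm ℤ → ¬ (4 : ℕ) ∣ W.conductorNorm ℤ →
    q ≠ 2 → ¬ (q : ℤ) ∣ (W.conductorNorm ℤ : ℤ) → jacobiSym W.Δ.num q = -1 → W'.conductorNorm ℤ = q * W.conductorNorm ℤ →
    ModTwoCongruent W W' → W'.HasMultiplicativeReductionAtPrime q →
      ((Even W'.analyticRank ↔ Even W.analyticRank) ↔ levelRaisedSignFactor W W' q = -1)

/-- **ES-29G `LevelRaisedSignLawAtTwoGood` — the GOOD-AT-2 case (`2 ∤ N_W`, `ρ̄|_{G_{ℚ₂}} ≠ 1`): the genuinely CONJECTURAL part = a FLAT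
RECIPROCITY AT 2** (MEMO-es §29.1 (ES-29♭)): for the components `(ψ = res χ_{d'}, ξ = β)` of the finite-flat mod-`4` difference cocycle,
`[(d', −Δ_W)₂ = −1] = Σ_{w ∣ 2} [(β, γ_W)_w = −1]`.  Census `v₂N = 0` frame: 21 748 / 21 748 (ordinary: both symbols occur and agree;
supersingular: both vanish, SR29 pilot 318/318); FALSE without `NontrivialAtTwo` (`ρ̄|_{G_{ℚ₂}} = 1`: 226 / 1 523 rows with `C₂ = 1`).
Why it might fail: a good-ordinary `2`-adic class with `ℚ₂(√f'_W(e_°))` ramified (the formal-group lemma says unit part `≡ 1 (4)`, valuation `−4`)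
or a supersingular class where `χ_{d'}` ramifies at `2`; `w(W) = +1` bases untested.
REF1-AUDIT §191 + §197: **SURVIVES**; ordinary part (T7) = (L-ord-i) `F′(X_°) ≡ b₂² ≡ 1 (mod 8)` + unique stable line ⟨T_°⟩ PASS (REF1); supersingular part (T8) REDUCED to and
PROVED from (L-ss-i) `loc₂γ_W = λ^{[a₂(W) ≠ 0]}`, `λ = 1+2π²` (a NON-square; `Λ = ⟨λ⟩ ⊂ ker N`), (L-ss-ii) `δ₂(W(ℚ₂)/2) = Λ` for EVERY good-ss `W`, (L-ss-iii) — hand proofs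
§30.9/§30.10 PASS (§197 P4–P6; no enumeration, no Honda); so on the sub-frame «odd part of `N_W` squarefree» ES-29G is a THEOREM on paper; as typed it keeps the additive-odd-p
residue (R197a).  REF2-PLACEMENT v53 §6.3 (T8) / §6.5: the STRUCTURAL half (L-ss-ii) «for E, E′ good supersingular at 2 with `E[2]|G_{ℚ₂} ≅ E′[2]|G_{ℚ₂}`: `L₂(E) = H¹_fl(ℤ₂, 𝓔[2]) =
L₂(E′)`, ONE canonical line for all supersingular E/ℚ₂» is a COROLLARY OF PRINT — [cite: Cesnavicius2016SelmerFlat, §5] (irreducible `𝔽₄`-line scheme over the strict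
henselisation + fpqc descent; cite HIS proposition, NOT «Raynaud e < p−1», which fails for ℤ₂) with [cite: Raynaud1974, §3.3.2] and the three Honda classes `a₂ ∈ {0, ±2}`
[cite: Honda1970]; (L-ss-i) = a THREE-CASE finite statement about the Honda formal groups, NOT IN PRINT (computation-grade; the dichotomy «`a₂ = 0 ⟺ loc₂γ_E = 0`» unlocated);
(L-ss-iii) NOT IN PRINT (Kisin-module route = print TOOL).  Cross-file (REF2 §14.1, to -imc): «`loc₂ γ_W = [type ±2]·Λ`» is the all-paper layer-0, `f = 3` instance of
type-visibility (`V(3) = S`, `F1Sign2/TowerKummerAtlasAtTwo.lean`). -/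
@[conjecture] def LevelRaisedSignLawAtTwoGood : Prop :=
  ∀ (W W' : WeierstrassCurve ℚ) [W.IsElliptic] [W.IsGloballyMinimal] [W'.IsElliptic] [W'.IsGloballyMinimal]
    (q : ℕ) [Fact q.Prime],
    ¬ W.HasCM → (∀ n : ℕ, W.HasSurjectiveModNGaloisRep ((2 ^ n : ℕ) : ℤ)) → Odd W.torsionOrder → Odd W.tamagawaProduct →
    ¬ (2 : ℕ) ∣ W.conductorNorm ℤ → NontrivialAtTwo W →
    q ≠ 2 → ¬ (q : ℤ) ∣ (W.conductorNorm ℤ : ℤ) → jacobiSym W.Δ.num q = -1 → W'.conductorNorm ℤ = q * W.conductorNorm ℤ →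
    ModTwoCongruent W W' → W'.HasMultiplicativeReductionAtPrime q →
      ((Even W'.analyticRank ↔ Even W.analyticRank) ↔ levelRaisedSignFactor W W' q = -1)

/-- GLUE: ES-29A = ES-29G ∧ ES-29M (split on `2 ∣ N_W`). -/
theorem signLaw_of_good_of_mult (hg : LevelRaisedSignLawAtTwoGood) (hm : LevelRaisedSignLawAtTwoMult) : LevelRaisedSignLawAtTwo := by
  intro W W' _ _ _ _ q _ h1 h2 h3 h4 h5 h6 hq hgood htr hlev hc hmq
  by_cases h2N : (2 : ℕ) ∣ W.conductorNorm ℤ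
  · exact hm W W' q h1 h2 h3 h4 h2N h5 hq hgood htr hlev hc hmq
  · exact hg W W' q h1 h2 h3 h4 h2N h6 hq hgood htr hlev hc hmq

/-- GLUE (-es; docstring added by the typer): ES-29A ⟹ ES-29G (`2 ∤ N_W ⟹ 4 ∤ N_W`). -/
theorem good_of_signLaw (h : LevelRaisedSignLawAtTwo) : LevelRaisedSignLawAtTwoGood := by
  intro W W' _ _ _ _ q _ h1 h2 h3 h4 h2N h6 hq hgood htr hlev hc hmq
  have h4N : ¬ (4 : ℕ) ∣ W.conductorNorm ℤ := fun h4' => h2N (Nat.dvd_trans ⟨2, rfl⟩ h4')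
  exact h W W' q h1 h2 h3 h4 h4N h6 hq hgood htr hlev hc hmq

/-- GLUE (-es; docstring added by the typer): ES-29A ⟺ ES-29G ∧ ES-29M, given `hmult_nontriv` — the TRUE fact (REF1-AUDIT §191: «no `NontrivialAtTwo` binder is needed at
`2 ∥ N_W`: `v₂(Δ_W)` odd forces `ρ̄|G_{ℚ₂} ≠ 1`», via `Odd W.tamagawaProduct ⟹ c₂` odd ⟹ `v₂(Δ_W)` odd, REF1 §196-add1 (c) / REF2 v53 §18), kept as a hypothesis in this
sign-algebra file. -/
theorem signLaw_iff_good_and_mult (hmult_nontriv : ∀ (W : WeierstrassCurve ℚ) [W.IsElliptic] [W.IsGloballyMinimal],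
      Odd W.tamagawaProduct → (2 : ℕ) ∣ W.conductorNorm ℤ → ¬ (4 : ℕ) ∣ W.conductorNorm ℤ → NontrivialAtTwo W) :
    LevelRaisedSignLawAtTwo ↔ (LevelRaisedSignLawAtTwoGood ∧ LevelRaisedSignLawAtTwoMult) := by
  constructor
  · intro h
    refine ⟨good_of_signLaw h, ?_⟩
    intro W W' _ _ _ _ q _ h1 h2 h3 h4 h2N h4N hq hgood htr hlev hc hmq
    exact h W W' q h1 h2 h3 h4 h4N (hmult_nontriv W h4 h2N h4N) hq hgood htr hlev hc hmq
  · rintro ⟨hg, hm⟩; exact signLaw_of_good_of_mult hg hm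

/-- **ES-29A♮ `LevelRaisedSignLawAtTwoSemistableOdd` — THE SIGN LAW ON THE SUB-FRAME «ODD PART OF `N_W` SQUAREFREE» (no ADDITIVE odd prime of `W`):** ES-29A's frame and
conclusion verbatim, plus the one binder `∀ p, p prime → p ≠ 2 → p ∣ N_W → p² ∤ N_W` (for odd `p`, `p² ∤ N_W ⟺ W` is not additive at `p`; with `Odd W.tamagawaProduct` every such `p`
is then multiplicative with `v_p(Δ_W)` odd, where the local sign identity `w_p(W)w_p(W') = (d',−Δ_W)_p(β,γ_W)_p` IS proved).  On this sub-frame the law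
`w(W')·w(W) = −ε_q·(ε*_q)^{t_q}·(−1)^{κ_∞}` is a THEOREM ON PAPER (MEMO-es §29 (T1)–(T8) + §30.8–§30.10, audited line by line by REF1 §191 + §197).
TYPED BY -ty g18 at REF1's request (R191a = R197a, REF1-AUDIT §197 «EITHER type the theorem version `LevelRaisedSignLawAtTwoSemistableOdd` := ES-29A's binders +
`∀ p : ℕ, p.Prime → p ≠ 2 → p ∣ W.conductorNorm ℤ → ¬ p ^ 2 ∣ W.conductorNorm ℤ` (for odd `p`, `p² ∤ N ⟺ p` not additive) — support text, provable on paper NOW; keep ES-29A/G/M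
`@[conjecture]` with the residue named»): body = ES-29A's body with that ONE extra binder inserted after `NontrivialAtTwo W` (binder text verbatim from REF1).  STATUS: **THEOREM ON
PAPER** — REF1 §191 + §197 audit of (T2)–(T8) complete end to end on exactly this sub-frame (every local identity re-derived or refereed; second engines SR29 217 966/217 966
per-place identities, R0-29 5 937/5 937, REF1 re-tallies); tagged `@[conjecture]` here ONLY because no Lean proof has landed (cell convention for the -es rows, D-es-64 / R197b);
`semistableOdd_of_signLaw` below: ES-29A ⟹ this (drop the binder).  REF2-PLACEMENT v53 §6/§15: statement NOT IN PRINT (it answers what [cite: LeHungLi2016, p. 3] call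
undetectable from the congruence), grade NEW-COMBINATION; §12.2(c) print-assembly route OPEN (E30-R1).  Frame count: 91 167 − 40 973 = 50 194 census rows lie on this sub-frame
(REF1 §194/§197).  PARTITION none; beyond-print theorem: pending a Lean proof (paper: yes per REF1; placement: REF2); BSD not proved. -/
@[conjecture] def LevelRaisedSignLawAtTwoSemistableOdd : Prop :=
  ∀ (W W' : WeierstrassCurve ℚ) [W.IsElliptic] [W.IsGloballyMinimal] [W'.IsElliptic] [W'.IsGloballyMinimal]
    (q : ℕ) [Fact q.Prime],
    ¬ W.HasCM → (∀ n : ℕ, W.HasSurjectiveModNGaloisRep ((2 ^ n : ℕ) : ℤ)) → Odd W.torsionOrder → Odd W.tamagawaProduct →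
    ¬ (4 : ℕ) ∣ W.conductorNorm ℤ → NontrivialAtTwo W →
    (∀ p : ℕ, p.Prime → p ≠ 2 → p ∣ W.conductorNorm ℤ → ¬ p ^ 2 ∣ W.conductorNorm ℤ) →
    q ≠ 2 → ¬ (q : ℤ) ∣ (W.conductorNorm ℤ : ℤ) → jacobiSym W.Δ.num q = -1 → W'.conductorNorm ℤ = q * W.conductorNorm ℤ →
    ModTwoCongruent W W' → W'.HasMultiplicativeReductionAtPrime q →
      ((Even W'.analyticRank ↔ Even W.analyticRank) ↔ levelRaisedSignFactor W W' q = -1)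

/-- GLUE (typer): ES-29A ⟹ ES-29A♮ (drop the «no additive odd prime» binder). -/
theorem semistableOdd_of_signLaw (h : LevelRaisedSignLawAtTwo) : LevelRaisedSignLawAtTwoSemistableOdd := by
  intro W W' _ _ _ _ q _ h1 h2 h3 h4 h5 h6 _hsq hq hgood htr hlev hc hm
  exact h W W' q h1 h2 h3 h4 h5 h6 hq hgood htr hlev hc hm

end Summit.BirchSwinnertonDyer.BirchSwinnertonDyer.Theorems.RankOneAtTwoSignReciprocity
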